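import Summits.SmoothPoincare4.SmoothPoincare4.Theorems.SullivanDualWitnessChargeBlowupCurve
import Mathlib.Geometry.Manifold.WhitneyEmbedding
import Mathlib.Topology.Sequences
import Mathlib.Topology.MetricSpace.Thickening
import Mathlib.Analysis.Convex.PathConnected
import Mathlib.Analysis.Normed.Module.Convex

/-!
# Extension of a family across a frontier point (EXT)

Crux `WitnessCharge` (stmt-SmoothPoincare4-7824), line `Sketch`, skeleton v7, stub `helper_familyExtend`.

Classical glue over three statement-hypotheses — the local chart `A'` of the moduli space of
pencil members (existence of a smooth local family `Floc` charted by the intercept, and its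
universality), the limit-member statement LIM⁺ (members with bounded convergent intercepts and
locally bounded gradients through a Whitney embedding `ι` subconverge, uniformly on compacts
through `ι`, to a member of the limit intercept) and the uniqueness statement UNIQ (continuous
families of members over an open preconnected set of intercepts agreeing at one intercept agree) —
together with the landed gradient blow-up theorem `substub_blowupCurve`.

Given a smooth family `F` of members over an open convex `D ⊆ ℂ` and `b⋆ ∈ closure D`:
take `bₙ ∈ D`, `bₙ → b⋆` (`mem_closure_iff_seq_limit`), bounded; Whitney-embed `Σ` by `ι`
(`exists_embedding_euclidean_of_compact`). If the gradients of `ι ∘ F bₙ` are unbounded on some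
disc, `substub_blowupCurve` gives `CurveAway`. Otherwise LIM⁺ gives a member `G` of intercept `b⋆`
and a subsequence `F b_{φ k} → G` uniformly on compacts through `ι`; `A'` at `G` gives
`δ, Floc, r₀, V`. The one topological lemma (`familyExtend_eventually_graph_mem`): for `k` large the
graph of `F b_{φ k}` over the disc `‖ξ‖ ≤ r₀` lies in the open `V` — the map
`(ξ, x) ↦ (ξ, ι x)` is an embedding `ℂ × (Σ∖p) → ℂ × ℝᴺ`, so `V` is the preimage of an open `O`;
the compact graph of `G` over the disc lies in `O`, hence so does an `η`-thickening of it
(`IsCompact.exists_thickening_subset_open`), and uniform convergence puts the graphs of the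
`F b_{φ k}` inside that thickening. Also `b_{φ k} ∈ ball b⋆ δ` for `k` large, so universality gives
`F b_{φ k} = Floc b_{φ k}`; UNIQ on the convex (hence preconnected) open set `D ∩ ball b⋆ δ` gives
`Floc = F` there; output `δ` and `F' = Floc`.
-/

noncomputable section

set_option linter.dupNamespace false

open scoped Manifold ContDiff Topology
open Set Filter Literature.Geometry.Kaehler Literature.Geometry.Symplectic
  Literature.Topology.FourManifolds

namespace Summit.SmoothPoincare4.SmoothPoincare4.Theorems.WitnessCharge.PencilIncompleteness

/-- **Graph thickening lemma.** Let `j : X → E` be a topological embedding into a metric space,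
`V ⊆ ℂ × X` open, `G : ℂ → X` continuous with graph in `V`, and `u k → G` uniformly on the closed
disc `‖ξ‖ ≤ r₀` through `j`. Then for `k` large the graph of `u k` over that disc lies in `V`.
Proof: `Prod.map id j` is an embedding, so `V = (Prod.map id j) ⁻¹' O` with `O` open; the compact
set `Γ = {(ξ, j (G ξ)) | ‖ξ‖ ≤ r₀} ⊆ O` has a thickening `thickening η Γ ⊆ O`
(`IsCompact.exists_thickening_subset_open`); if `dist (j (G ξ)) (j (u k ξ)) < η` on the disc then
`(ξ, j (u k ξ)) ∈ thickening η Γ ⊆ O` (the product distance is the max and the first coordinates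
agree), i.e. `(ξ, u k ξ) ∈ V`. -/
theorem familyExtend_eventually_graph_mem {X : Type*} [TopologicalSpace X]
    {E : Type*} [PseudoMetricSpace E] {j : X → E} (hj : Topology.IsEmbedding j)
    {V : Set (ℂ × X)} (hV : IsOpen V) {G : ℂ → X} (hG : Continuous G)
    (hgraph : ∀ ξ : ℂ, (ξ, G ξ) ∈ V) {u : ℕ → ℂ → X} (r₀ : ℝ)
    (hunif : TendstoUniformlyOn (fun k ζ => j (u k ζ)) (fun ζ => j (G ζ)) atTop
      (Metric.closedBall (0 : ℂ) r₀)) :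
    ∀ᶠ k in atTop, ∀ ξ : ℂ, ‖ξ‖ ≤ r₀ → (ξ, u k ξ) ∈ V := by
  -- the embedding `Ψ = Prod.map id j : ℂ × X → ℂ × E`
  have hΨ : Topology.IsEmbedding (Prod.map (id : ℂ → ℂ) j) :=
    Topology.IsEmbedding.id.prodMap hj
  obtain ⟨O, hO, hOV⟩ := hΨ.isInducing.isOpen_iff.1 hV
  -- the compact graph of `G` over the disc, pushed into `ℂ × E`
  set Γ : Set (ℂ × E) := (fun ξ : ℂ => ((ξ, j (G ξ)) : ℂ × E)) '' Metric.closedBall (0 : ℂ) r₀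
  have hΓc : IsCompact Γ :=
    (isCompact_closedBall (0 : ℂ) r₀).image
      (continuous_id.prodMk (hj.continuous.comp hG))
  have hΓO : Γ ⊆ O := by
    rintro q ⟨ξ, -, rfl⟩
    have h : (ξ, G ξ) ∈ Prod.map (id : ℂ → ℂ) j ⁻¹' O := by
      rw [hOV]
      exact hgraph ξ
    simpa only [mem_preimage, Prod.map_apply, id_eq] using h
  obtain ⟨η, hη, hthick⟩ := hΓc.exists_thickening_subset_open hO hΓO
  -- uniform convergence on the disc
  have hev := Metric.tendstoUniformlyOn_iff.1 hunif η hη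
  filter_upwards [hev] with k hk ξ hξ
  have hξ' : ξ ∈ Metric.closedBall (0 : ℂ) r₀ := mem_closedBall_zero_iff.2 hξ
  have hd : dist (j (G ξ)) (j (u k ξ)) < η := hk ξ hξ'
  -- `(ξ, j (u k ξ))` lies in the thickening, hence in `O`
  have hmem : ((ξ, j (u k ξ)) : ℂ × E) ∈ Metric.thickening η Γ := by
    rw [Metric.mem_thickening_iff]
    refine ⟨(ξ, j (G ξ)), ⟨ξ, hξ', rfl⟩, ?_⟩
    rw [Prod.dist_eq, dist_self, dist_comm]
    exact max_lt hη hd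
  have hO' : Prod.map (id : ℂ → ℂ) j (ξ, u k ξ) ∈ O := by
    simpa only [Prod.map_apply, id_eq] using hthick hmem
  have : (ξ, u k ξ) ∈ Prod.map (id : ℂ → ℂ) j ⁻¹' O := hO'
  rwa [hOV] at this

/-- **EXT — extension of a family across a frontier point** (from the chart-with-universality
statement `A'` (`hA`), the limit-member statement LIM⁺ (`hLim`) and the uniqueness statement UNIQ
(`hUniq`), with the landed `substub_blowupCurve`). For a smooth family `F` of pencil members with
injective differential over an open convex `D ⊆ ℂ` and `b⋆ ∈ closure D`: either `CurveAway S p J`,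
or there are `δ > 0` and a smooth family `F'` of members with injective differential over
`ball b⋆ δ` agreeing with `F` on `D ∩ ball b⋆ δ`. Take `bₙ ∈ D → b⋆` (bounded), a Whitney embedding
`ι` of `Σ`; if the gradients of `ι ∘ F bₙ` blow up on a disc, `substub_blowupCurve` gives
`CurveAway`; otherwise LIM⁺ gives a member `G` of intercept `b⋆` with `F b_{φ k} → G` uniformly on
compacts through `ι`; `A'` at `G` gives `δ, Floc, r₀, V`; for `k` large the graph of `F b_{φ k}` over
`‖ξ‖ ≤ r₀` lies in `V` (`familyExtend_eventually_graph_mem`) and `b_{φ k} ∈ ball b⋆ δ`, so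
`F b_{φ k} = Floc b_{φ k}` by universality; UNIQ on the convex open `D ∩ ball b⋆ δ` gives `Floc = F`
there; output `δ` and `F' = Floc`. -/
theorem helper_familyExtend :
    ∀ (S : HomotopySphere 4) (p : S.carrier)
      (J : ∀ x : punctured p, TangentSpace (𝓡 4) x →L[ℝ] TangentSpace (𝓡 4) x) (ε' : ℝ),
      0 < ε' →
      Metric.closedBall (extChartAt (𝓡 4) p p) ε' ⊆ (extChartAt (𝓡 4) p).target →
      (∀ (x : punctured p) (v : TangentSpace (𝓡 4) x), J x (J x v) = -v) →
      (∀ x₀ : punctured p, ContMDiffAt (𝓡 4) 𝓘(ℝ, EuclideanSpace ℝ (Fin 4) →L[ℝ] EuclideanSpace ℝ (Fin 4)) ∞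
        (inTangentCoordinates (𝓡 4) (𝓡 4) (id : punctured p → punctured p) id (fun x => J x) x₀) x₀) →
      (∀ x : punctured p, InPuncturedChartBall p ε' x →
        ∀ (v : TangentSpace (𝓡 4) x) (b : EuclideanSpace ℝ (Fin 4)),
          inner ℝ (fderiv ℝ inversion (extChartAt (𝓡 4) p x.1 - extChartAt (𝓡 4) p p)
            (mfderiv (𝓡 4) 𝓘(ℝ, EuclideanSpace ℝ (Fin 4))
              (fun z : punctured p => extChartAt (𝓡 4) p z.1) x (J x v))) b
          = stdSymplecticForm (fderiv ℝ inversion (extChartAt (𝓡 4) p x.1 - extChartAt (𝓡 4) p p)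
            (mfderiv (𝓡 4) 𝓘(ℝ, EuclideanSpace ℝ (Fin 4))
              (fun z : punctured p => extChartAt (𝓡 4) p z.1) x v)) b) →
      (∀ (u₀ : ℂ → punctured p) (b₀ : ℂ), IsPencilMember J u₀ b₀ →
        ∃ δ : ℝ, 0 < δ ∧ ∃ Floc : ℂ → ℂ → punctured p, Floc b₀ = u₀ ∧
          (∀ b ∈ Metric.ball b₀ δ, IsPencilMember J (Floc b) b) ∧
          ContMDiffOn 𝓘(ℝ, ℂ × ℂ) (𝓡 4) ∞ (fun q : ℂ × ℂ => Floc q.1 q.2)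
            ((Metric.ball b₀ δ) ×ˢ (univ : Set ℂ)) ∧
          (∀ q : ℂ × ℂ, q.1 ∈ Metric.ball b₀ δ →
            Function.Injective (mfderiv 𝓘(ℝ, ℂ × ℂ) (𝓡 4) (fun q : ℂ × ℂ => Floc q.1 q.2) q)) ∧
          ∃ (r₀ : ℝ) (V : Set (ℂ × punctured p)), IsOpen V ∧ (∀ ξ : ℂ, (ξ, u₀ ξ) ∈ V) ∧
            ∀ (u : ℂ → punctured p) (b : ℂ), IsPencilMember J u b → b ∈ Metric.ball b₀ δ →
              (∀ ξ : ℂ, ‖ξ‖ ≤ r₀ → (ξ, u ξ) ∈ V) → u = Floc b) →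
      (∀ (N : ℕ) (ι : S.carrier → EuclideanSpace ℝ (Fin N)),
        ContMDiff (𝓡 4) 𝓘(ℝ, EuclideanSpace ℝ (Fin N)) ∞ ι → Function.Injective ι →
        (∀ x : S.carrier, Function.Injective (mfderiv (𝓡 4) 𝓘(ℝ, EuclideanSpace ℝ (Fin N)) ι x)) →
      ∀ (u : ℕ → ℂ → punctured p) (b : ℕ → ℂ) (bstar : ℂ) (B : ℝ),
        (∀ n, IsPencilMember J (u n) (b n)) → (∀ n, ‖b n‖ ≤ B) →
        Tendsto b atTop (𝓝 bstar) →
        (∀ r : ℝ, ∃ L : ℝ, ∀ n : ℕ, ∀ ξ : ℂ, ‖ξ‖ ≤ r →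
          ‖fderiv ℝ (fun w : ℂ => ι (u n w).1) ξ‖ ≤ L) →
        ∃ (G : ℂ → punctured p) (φ : ℕ → ℕ), StrictMono φ ∧ IsPencilMember J G bstar ∧
          ∀ D : Set ℂ, IsCompact D →
            TendstoUniformlyOn (fun n ζ => ι (u (φ n) ζ).1) (fun ζ => ι (G ζ).1) atTop D) →
      (∀ (D : Set ℂ) (F₁ F₂ : ℂ → ℂ → punctured p), IsOpen D → IsPreconnected D →
        (∀ b ∈ D, IsPencilMember J (F₁ b) b) → (∀ b ∈ D, IsPencilMember J (F₂ b) b) →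
        ContinuousOn (fun q : ℂ × ℂ => F₁ q.1 q.2) (D ×ˢ (univ : Set ℂ)) →
        ContinuousOn (fun q : ℂ × ℂ => F₂ q.1 q.2) (D ×ˢ (univ : Set ℂ)) →
        (∃ b₀ ∈ D, F₁ b₀ = F₂ b₀) → ∀ b ∈ D, F₁ b = F₂ b) →
      ∀ (D : Set ℂ) (F : ℂ → ℂ → punctured p) (bstar : ℂ), IsOpen D → Convex ℝ D →
        ((∀ b ∈ D, IsPencilMember J (F b) b) ∧
          ContMDiffOn 𝓘(ℝ, ℂ × ℂ) (𝓡 4) ∞ (fun q : ℂ × ℂ => F q.1 q.2) ((D) ×ˢ (univ : Set ℂ)) ∧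
          (∀ q : ℂ × ℂ, q.1 ∈ D →
            Function.Injective (mfderiv 𝓘(ℝ, ℂ × ℂ) (𝓡 4) (fun q : ℂ × ℂ => F q.1 q.2) q))) →
        bstar ∈ closure D →
        CurveAway S p J ∨ ∃ δ : ℝ, 0 < δ ∧ ∃ F' : ℂ → ℂ → punctured p,
          ((∀ b ∈ Metric.ball bstar δ, IsPencilMember J (F' b) b) ∧
            ContMDiffOn 𝓘(ℝ, ℂ × ℂ) (𝓡 4) ∞ (fun q : ℂ × ℂ => F' q.1 q.2) ((Metric.ball bstar δ) ×ˢ (univ : Set ℂ)) ∧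
            (∀ q : ℂ × ℂ, q.1 ∈ Metric.ball bstar δ →
              Function.Injective (mfderiv 𝓘(ℝ, ℂ × ℂ) (𝓡 4) (fun q : ℂ × ℂ => F' q.1 q.2) q))) ∧
          ∀ b ∈ D ∩ Metric.ball bstar δ, F' b = F b := by
  intro S p J ε' hε' hball hJ2 hJs hJstd hA hLim hUniq D F bstar hD hDconv hF hbstar
  obtain ⟨hmem, hsmooth, -⟩ := hF
  classical
  by_cases hcurve : CurveAway S p J
  · exact Or.inl hcurve
  refine Or.inr ?_
  -- (1) a sequence of intercepts `b n ∈ D`, `b n → b⋆`, bounded by `B`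
  obtain ⟨b, hbD, hblim⟩ := mem_closure_iff_seq_limit.mp hbstar
  obtain ⟨B, hB⟩ : ∃ B : ℝ, ∀ n : ℕ, ‖b n‖ ≤ B := by
    obtain ⟨B, hB⟩ := (Metric.isBounded_range_of_tendsto b hblim).exists_norm_le
    exact ⟨B, fun n => hB _ (mem_range_self n)⟩
  -- (2) a Whitney embedding of `Σ`
  obtain ⟨N, ι, hιs, hιemb, hιd⟩ :=
    exists_embedding_euclidean_of_compact (I := 𝓡 4) (M := S.carrier)
  -- (3) dichotomy on the gradients of `ι ∘ F (b n)` on discs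
  by_cases hN : ∀ r : ℝ, ∃ L : ℝ, ∀ n : ℕ, ∀ ξ : ℂ, ‖ξ‖ ≤ r →
      ‖fderiv ℝ (fun w : ℂ => ι (F (b n) w).1) ξ‖ ≤ L
  swap
  · -- gradient blow-up: `substub_blowupCurve` gives `CurveAway`, excluded
    push Not at hN
    obtain ⟨r, hr⟩ := hN
    exact absurd (substub_blowupCurve S p J ε' hε' hball hJ2 hJs hJstd N ι hιs hιemb.injective hιd
      (fun n => F (b n)) b B r (fun n => hmem _ (hbD n)) hB hr) hcurve
  -- (4) the limit member `G` of intercept `b⋆`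
  obtain ⟨G, φ, hφ, hG, hunif⟩ := hLim N ι hιs hιemb.injective hιd (fun n => F (b n)) b bstar B
    (fun n => hmem _ (hbD n)) hB hblim hN
  -- (5) the chart of `A'` at `G`
  obtain ⟨δ, hδ, Floc, -, hFmem, hFsmooth, hFinjd, r₀, V, hV, hgraph, huniv⟩ := hA G bstar hG
  -- (6) for `k` large the graph of `F (b (φ k))` over the disc `‖ξ‖ ≤ r₀` lies in `V`
  have hemb : Topology.IsEmbedding (fun x : punctured p => ι x.1) :=
    (hιs.continuous.isClosedEmbedding hιemb.injective).isEmbedding.comp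
      Topology.IsEmbedding.subtypeVal
  have hGcont : Continuous G := hG.1.contMDiff.continuous
  have hev₁ : ∀ᶠ k in atTop, ∀ ξ : ℂ, ‖ξ‖ ≤ r₀ → (ξ, F (b (φ k)) ξ) ∈ V :=
    familyExtend_eventually_graph_mem (u := fun k => F (b (φ k))) hemb hV hGcont hgraph r₀
      (hunif _ (isCompact_closedBall (0 : ℂ) r₀))
  -- (7) for `k` large `b (φ k) ∈ ball b⋆ δ`; pick one such `k` and apply universality
  have hev₂ : ∀ᶠ k in atTop, dist (b (φ k)) bstar < δ :=
    Metric.tendsto_nhds.1 (hblim.comp hφ.tendsto_atTop) δ hδ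
  obtain ⟨k, hk₁, hk₂⟩ := (hev₁.and hev₂).exists
  have hkball : b (φ k) ∈ Metric.ball bstar δ := Metric.mem_ball.2 hk₂
  have hkeq : F (b (φ k)) = Floc (b (φ k)) :=
    huniv (F (b (φ k))) (b (φ k)) (hmem _ (hbD _)) hkball hk₁
  -- (8) UNIQ on the convex open set `W = D ∩ ball b⋆ δ`
  have hW : IsOpen (D ∩ Metric.ball bstar δ) := hD.inter Metric.isOpen_ball
  have hWc : IsPreconnected (D ∩ Metric.ball bstar δ) :=
    (hDconv.inter (convex_ball bstar δ)).isPreconnected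
  have hc₁ : ContinuousOn (fun q : ℂ × ℂ => F q.1 q.2) ((D ∩ Metric.ball bstar δ) ×ˢ (univ : Set ℂ)) :=
    hsmooth.continuousOn.mono (prod_mono inter_subset_left Subset.rfl)
  have hc₂ : ContinuousOn (fun q : ℂ × ℂ => Floc q.1 q.2)
      ((D ∩ Metric.ball bstar δ) ×ˢ (univ : Set ℂ)) :=
    hFsmooth.continuousOn.mono (prod_mono inter_subset_right Subset.rfl)
  have hagree : ∀ b' ∈ D ∩ Metric.ball bstar δ, F b' = Floc b' :=
    hUniq (D ∩ Metric.ball bstar δ) F Floc hW hWc (fun b' hb' => hmem b' hb'.1)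
      (fun b' hb' => hFmem b' hb'.2) hc₁ hc₂ ⟨b (φ k), ⟨hbD _, hkball⟩, hkeq⟩
  -- (9) output
  exact ⟨δ, hδ, Floc, ⟨hFmem, hFsmooth, hFinjd⟩, fun b' hb' => (hagree b' hb').symm⟩

end Summit.SmoothPoincare4.SmoothPoincare4.Theorems.WitnessCharge.PencilIncompleteness
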